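import Summits.ResolutionOfSingularities.ResolutionOfSingularities.Theorems.MarkedTransferCampaignW46ThreefoldsTauThreeSlice
import HarnessLib

/-!
# [OURS · L1 W4.6 rung (ii-τ)] THE MAXIMAL-τ ISOLATED SLICE OF THE HOST ITEM — stmt-16156's literal conclusion
# (`IsMarkedResolution ⟨I, E, m⟩`, ANY simple-normal-crossings boundary `E`) for inputs whose order-`m` locus is a finite
# set of threefold points with `τ = 3`, PROVED (one B-permissible blowing up)

Cell res-hironaka, LADDER-RESOLUTION rung L (D-0089), slot W4.6, rung (ii) (threefold hypersurfaces); seat res-L1-s46-pv-3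
(gen 3). Host route MarkedTransfer, host item `HypersurfaceOrderReductionDimLeThree` (stmt-ResolutionOfSingularities-16156);
filed `--kind proof --supports` it `--as helper`. OURS scheme theory over PROVED tree lemmas (Cossart–Piltant 2008
Lemma 4.3 (1), kernel-checked in the tree); nothing of H. Hironaka's manuscript is asserted; the route file is NOT
imported (the host's binders are copied verbatim). AI-written; AI review is weaker than expert review. Host-shape twin of
`…ThreefoldsTauThreeSlice.lean` (p509471).

## What is proved (no new definitions)

* `CampaignW46.hasSNCWith_vanishingIdeal_finite_of_hasSNC` — **a finite set of closed points has simple normal crossings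
  with EVERY simple-normal-crossings boundary** (its stalk ideal at each of its points is the whole maximal ideal, spanned
  by the whole adapted regular system of parameters): blowing it up is B-PERMISSIBLE for any `E`.
* `CampaignW46.exists_isMarkedResolution_of_finite_tau_eq_three` — **HOST SHAPE**: `X` regular locally Noetherian, `E` a
  simple-normal-crossings boundary, `J`, `m`; if the points of order `≥ m` form a finite set `S` of closed points with
  `ord = m`, embedding dimension `3` and `τ = 3` at each, then `(X, J, E, m)` has a BGMW marked resolution — the single
  blowing up along `𝓘_S` (regular centre inside the support, SNC with `E`), whose transform has EMPTY support.
* `CampaignW46.hostItem_tau_three_slice` — stmt-16156's binders VERBATIM (universe-polymorphic) plus the slice hypothesis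
  ⇒ stmt-16156's conclusion VERBATIM.

HONEST VALUE. A partial result on the calibration item's LITERAL conclusion with non-monomial, characteristic-free
content (e.g. every threefold hypersurface input whose double-point locus is a finite set of ordinary double points, with
any SNC boundary, `m = 2`). Nothing about `τ ≤ 2` or positive-dimensional order-`m` loci.

References: `…ThreefoldsTauThreeSlice.lean` (p509471: `stalkIdeal_vanishingIdeal_finite_eq_maximalIdeal`,
`isRegular_subscheme_vanishingIdeal_finite`), tree `Resolution/NearPointsPointCentre.lean` [CossartPiltant2008, Lemma 4.3 (1)],
`Resolution/MarkedIdeals.lean` (`IsMultipleBlowup.single`, `IsMarkedResolution`, `HasSNCWith` [BierstoneGrigorievMilmanWlodarczyk2011,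
Def. 3.1.3]). H. Hironaka, ms. 2017-03-23 — scope only, under adjudication, not cited as fact. [Hironaka2017]
-/

noncomputable section

set_option linter.dupNamespace false -- mandated namespace of this single-conjunct summit

open CategoryTheory AlgebraicGeometry TopologicalSpace IsLocalRing

namespace Summit.ResolutionOfSingularities.ResolutionOfSingularities.Theorems

namespace CampaignW46

open Literature.AlgebraicGeometry.Resolution
open Scheme.IdealSheafData

universe u

variable {X : Scheme.{u}}

/-- **A finite set of closed points has simple normal crossings with every simple-normal-crossings boundary**: at a point
`x` of the set the stalk of its reduced ideal is `𝔪_x`, the span of the WHOLE adapted regular system of parameters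
provided by `HasSNC E` at `x`. [cite: BierstoneGrigorievMilmanWlodarczyk2011, Def. 3.1.3 (2)] -/
theorem hasSNCWith_vanishingIdeal_finite_of_hasSNC {E : List X.IdealSheafData} (hE : HasSNC E) {S : Set X}
    (hS : S.Finite) (hSc : ∀ x ∈ S, IsClosed ({x} : Set X)) :
    HasSNCWith E (vanishingIdeal ⟨S, isClosed_of_finite_of_isClosed_singleton hS hSc⟩) := by
  intro y
  obtain ⟨hreg, u, hu, hι, -⟩ := hE y
  refine ⟨hreg, u, hu, hι, fun hy => ⟨Set.univ, ?_⟩⟩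
  have hy' : y ∈ S := by
    rw [← SetLike.mem_coe, coe_support_vanishingIdeal] at hy
    exact hy
  rw [stalkIdeal_vanishingIdeal_finite_eq_maximalIdeal hS hSc hy', Set.image_univ, hu]

/-- **THE MAXIMAL-τ ISOLATED SLICE, HOST SHAPE.** `X` regular locally Noetherian, `E` a simple-normal-crossings boundary,
`J` an ideal sheaf, `m : ℕ`; if every point of order `≥ m` lies in a finite set `S` of closed points at each of which
`ord_x J = m`, the embedding dimension is `3` and `τ_x(J, m) = 3`, then the marked ideal `(X, J, E, m)` has a BGMW marked
resolution: the single blowing up along `𝓘_S` (a regular centre inside `supp(J, m)`, with simple normal crossings with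
`E`), after which the support is EMPTY (Cossart–Piltant 2008 Lemma 4.3 (1) over `S`, nothing changes off `S`).
[cite: CossartPiltant2008, Lemma 4.3 (1)] -/
theorem exists_isMarkedResolution_of_finite_tau_eq_three [IsLocallyNoetherian X] (hX : Scheme.IsRegular X)
    (J : X.IdealSheafData) (E : List X.IdealSheafData) (hE : HasSNC E) {m : ℕ} (S : Set X) (hS : S.Finite)
    (hSc : ∀ x ∈ S, IsClosed ({x} : Set X)) (hJS : ∀ x : X, (m : ℕ∞) ≤ idealOrder J x → x ∈ S)
    (hord : ∀ x ∈ S, idealOrder J x = m)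
    (hdim : ∀ x ∈ S, haveI := hX x; (maximalIdeal (X.presheaf.stalk x)).spanFinrank = 3)
    (hτ : ∀ x ∈ S, haveI := hX x; stalkTau J x m = 3) :
    ∃ (X' : Scheme.{u}) (Φ : X' ⟶ X) (M' : MarkedIdeal X'), IsMarkedResolution (⟨J, E, m⟩ : MarkedIdeal X) Φ M' := by
  set Sc : Closeds X := ⟨S, isClosed_of_finite_of_isClosed_singleton hS hSc⟩ with hScdef
  have hreg : Scheme.IsRegular (vanishingIdeal Sc).subscheme := isRegular_subscheme_vanishingIdeal_finite hS hSc
  have hY : ∀ y ∈ (Sc : Set X), idealOrder J y = m := fun y hy => hord y hy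
  have hsupp : ((vanishingIdeal Sc).support : Set X) ⊆ (⟨J, E, m⟩ : MarkedIdeal X).support := by
    intro y hy
    rw [coe_support_vanishingIdeal] at hy
    exact (hord y hy).ge
  have hsnc : HasSNCWith E (vanishingIdeal Sc) := hasSNCWith_vanishingIdeal_finite_of_hasSNC hE hS hSc
  obtain ⟨X', π, hπ⟩ := exists_isBlowup X (vanishingIdeal Sc)
  haveI : IsProper π := hπ.isProper
  haveI : IsLocallyNoetherian X' := LocallyOfFiniteType.isLocallyNoetherian π
  refine ⟨X', π, (⟨J, E, m⟩ : MarkedIdeal X).transform π (vanishingIdeal Sc),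
    IsMultipleBlowup.single _ _ π hπ hreg hsupp hsnc, ?_⟩
  -- the support of the transform is empty
  ext x'
  simp only [Set.mem_empty_iff_false, iff_false]
  change ¬ ((m : ℕ∞) ≤ idealOrder (controlledTransform π (vanishingIdeal Sc) J m) x')
  rw [not_le]
  by_cases hmem : π x' ∈ ((vanishingIdeal Sc).support : Set X)
  · rw [coe_support_vanishingIdeal] at hmem
    have hxS : π x' ∈ S := hmem
    haveI := hX (π x')
    obtain ⟨c₀, hc₀⟩ := exists_regularSystemOfParameters (R := X.presheaf.stalk (π x'))
    have hd := hdim (π x') hxS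
    let c : Fin 3 → X.presheaf.stalk (π x') := fun i => c₀ (i.cast hd.symm)
    have hrange : Set.range c = Set.range c₀ := by
      ext a
      constructor
      · rintro ⟨i, rfl⟩; exact ⟨i.cast hd.symm, rfl⟩
      · rintro ⟨i, rfl⟩; exact ⟨i.cast hd, by simp [c]⟩
    have hc : Ideal.span (Set.range c) = maximalIdeal _ := by rw [hrange, hc₀]
    have hcY : Ideal.span (Set.range c) = stalkIdeal (vanishingIdeal Sc) (π x') := by
      rw [hc, stalkIdeal_vanishingIdeal_finite_eq_maximalIdeal hS hSc hxS]
    exact hπ.idealOrder_controlledTransform_lt_of_stalkTau_eq_three hX hreg hY hd hc hcY (hτ (π x') hxS)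
  · rw [hπ.idealOrder_controlledTransform_of_not_mem J m hmem]
    by_contra hge
    rw [not_lt] at hge
    apply hmem
    rw [coe_support_vanishingIdeal]
    exact hJS _ hge

/-- **THE MAXIMAL-τ ISOLATED SLICE OF THE HOST ITEM stmt-16156, binders VERBATIM** (universe-polymorphic) plus the slice
hypothesis «the points of order `≥ m` form a finite set of closed points with `ord = m`, embedding dimension `3` and
`τ = 3`» ⇒ stmt-16156's CONCLUSION VERBATIM, for EVERY simple-normal-crossings boundary `E`.
[cite: CossartPiltant2008, Lemma 4.3 (1)] -/
theorem hostItem_tau_three_slice :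
    ∀ p : ℕ, p.Prime → ∀ (k : Type u) [Field k] [CharP k p] [PerfectField k] (X : Scheme.{u}) (s : X ⟶ Spec (.of k)),
      IsSeparated s → LocallyOfFiniteType s → QuasiCompact s → IsIntegral X → ∀ (hreg : Scheme.IsRegular X),
        topologicalKrullDim X ≤ 3 → ∀ (I : X.IdealSheafData), I ≠ ⊥ → IsEffectiveCartier I →
          ∀ (E : List X.IdealSheafData), HasSNC E → ∀ (m : ℕ), 1 ≤ m →
            ∀ (S : Set X), S.Finite → (∀ x ∈ S, IsClosed ({x} : Set X)) →
              (∀ x : X, (m : ℕ∞) ≤ idealOrder I x → x ∈ S) → (∀ x ∈ S, idealOrder I x = m) →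
                (∀ x ∈ S, haveI := hreg x; (maximalIdeal (X.presheaf.stalk x)).spanFinrank = 3) →
                  (∀ x ∈ S, haveI := hreg x; stalkTau I x m = 3) →
                    ∃ (X' : Scheme.{u}) (Φ : X' ⟶ X) (M' : MarkedIdeal X'),
                      IsMarkedResolution (⟨I, E, m⟩ : MarkedIdeal X) Φ M' := by
  intro _ _ k _ _ _ X s _ hloft _ _ hreg _ I _ _ E hE m _ S hS hSc hJS hord hdim hτ
  haveI : IsLocallyNoetherian X := LocallyOfFiniteType.isLocallyNoetherian s
  exact exists_isMarkedResolution_of_finite_tau_eq_three hreg I E hE S hS hSc hJS hord hdim hτ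

end CampaignW46

end Summit.ResolutionOfSingularities.ResolutionOfSingularities.Theorems

end
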